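/-
Copyright (c) 2026 the pub-hodgecm-mathlib formalisation cell (harness21).  Prover seat hodgecm-mathlib-K2Liu-p11 (g0), Track B «K2-LIT»,
#184♮ = hLiu418 = `stmt-HodgeConjecture-24832`; LEAD F0P6-plan (g12) DEAL 2026-09-04T06:56:46Z ∕ «= ×3» 07:19:04Z, SIGS-RoadI-v3 §Hol
row H1-E (K2E5-plan (g5)), file E-5 of H1-E (the CR-Cartan form).  THEOREMS ONLY (no `def`, no `instance`, no notation,
no named-fact hypothesis, no `sorry`).
-/
import Summits.HodgeConjecture.HodgeConjecture.Theorems.K2LiuHermitianTubeCRDictionary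
import HarnessLib

/-!
# Crux `HLiu418`, Road I, organ H1-E: the hermitian-tube Cauchy–Riemann dictionary, CARTAN form `D(μ b) = i·D(σ b)`

Cell `hodgecm-mathlib`, crux item hLiu418 = `stmt-HodgeConjecture-24832` (helper lane `--supports`, count-neutral).

* §1 The compact letter `κ(b) = (0 b; −b 0)` (`b` hermitian): `κ(b) ∈ 𝔲(J)`, `σ(b) = (0 b; b 0) ∈ 𝔲(J)`, `2ν(b) = σ(b) + κ(b)`, and
  `exp (t κ(b))` is a ROTATION `(A B; −B A)` with `AᴴA + BᴴB = 1`, `AᴴB = BᴴA` — hence (★ H1-B `rotation_mem_and_moeb_I`) it FIXES `i·1`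
  (`moeb_exp_smul_kappa`; via `J κ = κ J`, ★ `Matrix.exp_units_conj`, `Matrix.exp_conjTranspose`, `Matrix.exp_neg` — no matrix norm).
* §2 The `K∞`-TYPE DERIVATIVE: under (T) and (L), `D s (κ b) g = i·k_s·tr(b)·Φ g` (`lieDeriv_kappa`; ★ E-3 Jacobi
  `exists_hasFDerivAt_det_denom_exp` along `t ↦ t•κ(b)` + `hasDerivAt_zpow` + uniqueness of derivatives).
* §3 `exists_holDescend_of_lieCR` — THE H1-E HEAD in CARTAN form: hypothesis (CR-Cartan) `D s (μ b) g = i·D s (σ b) g` (the tube `𝔭⁻`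
  letters of ★ `K2LiuHermitianTubeFramePMinus.mu_sub_I_smul_sigma_eq`, K2Liu-p10 (g0)) instead of (CR-P); reduced to ★ E-4c
  `exists_holDescend_of_lieCRP` by `μ − 2iν = (μ − iσ) − iκ` and §2.
References: [Shimura1997, §§5–6]; [Knapp1986, Ch. VI §2]; [Bump1997, §2.1].
HONEST LABEL: HC_CM is proved only modulo the 7 printed citations (2 remaining named inputs: hLiu418 = stmt-HodgeConjecture-24832,
h413 = stmt-HodgeConjecture-24833) until rung 0 closes; count-neutral helper, closes no socket.
-/

set_option autoImplicit false
set_option linter.dupNamespace false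

noncomputable section

open scoped Matrix Topology ComplexOrder
open Filter Set NormedSpace Complex Matrix
open Literature.NumberTheory.ModularForms.SiegelUpperHalfSpace (num denom moeb num_def denom_def moeb_def moeb_one)
open Literature.AlgebraicGeometry.ShimuraVarieties.KudlaRapoport2013.Sec11Sec12MainTheorem (hermUpperHalfSpace)
open Summit.HodgeConjecture.HodgeConjecture.Cruxes.HLiu418.K2LiuHermitianTubeCocycle
open Summit.HodgeConjecture.HodgeConjecture.Cruxes.HLiu418.K2LiuHermitianTubeAction
open Summit.HodgeConjecture.HodgeConjecture.Cruxes.HLiu418.K2LiuLieRayDifferentiability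
open Summit.HodgeConjecture.HodgeConjecture.Cruxes.HLiu418.K2LiuHermitianTubeDescend
open Summit.HodgeConjecture.HodgeConjecture.Cruxes.HLiu418.K2LiuHermitianTubeCRDeriv
open Summit.HodgeConjecture.HodgeConjecture.Cruxes.HLiu418.K2LiuHermitianTubeCRDictionary

namespace Summit.HodgeConjecture.HodgeConjecture.Cruxes.HLiu418.K2LiuHermitianTubeCRCartan

variable {l : Type*} [Fintype l] [DecidableEq l]

/-! ## §1 The compact letter `κ(b)` and its one-parameter group of rotations -/

/-- `σ(b) = (0 b; b 0) ∈ 𝔲(J)` for hermitian `b`. [cite: Shimura1997, §5.6] -/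
theorem sigma_gen_mem {b : Matrix l l ℂ} (hb : bᴴ = b) :
    (fromBlocks 0 b b 0 : Matrix (l ⊕ l) (l ⊕ l) ℂ)ᴴ * Matrix.J l ℂ + Matrix.J l ℂ * fromBlocks 0 b b 0 = 0 := by
  rw [Matrix.J, fromBlocks_conjTranspose, fromBlocks_multiply, fromBlocks_multiply, fromBlocks_add, hb]
  simp [fromBlocks_zero]

/-- `κ(b) = (0 b; −b 0) ∈ 𝔲(J)` for hermitian `b`. [cite: Shimura1997, §5.6] -/
theorem kappa_gen_mem {b : Matrix l l ℂ} (hb : bᴴ = b) :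
    (fromBlocks 0 b (-b) 0 : Matrix (l ⊕ l) (l ⊕ l) ℂ)ᴴ * Matrix.J l ℂ + Matrix.J l ℂ * fromBlocks 0 b (-b) 0 = 0 := by
  rw [Matrix.J, fromBlocks_conjTranspose, fromBlocks_multiply, fromBlocks_multiply, fromBlocks_add, conjTranspose_neg, hb]
  simp [fromBlocks_zero]

omit [Fintype l] [DecidableEq l] in
/-- `2ν(b) = σ(b) + κ(b)`. [folklore] -/
theorem two_smul_transl_gen (b : Matrix l l ℂ) :
    (2 : ℝ) • (fromBlocks 0 b 0 0 : Matrix (l ⊕ l) (l ⊕ l) ℂ) = (1 : ℝ) • fromBlocks 0 b b 0 + fromBlocks 0 b (-b) 0 := by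
  rw [one_smul, fromBlocks_add, fromBlocks_smul, add_zero, add_neg_cancel, smul_zero, two_smul]

/-- `κ(b)` commutes with `J`. [folklore] -/
theorem J_mul_kappa (b : Matrix l l ℂ) :
    Matrix.J l ℂ * (fromBlocks 0 b (-b) 0 : Matrix (l ⊕ l) (l ⊕ l) ℂ) = fromBlocks 0 b (-b) 0 * Matrix.J l ℂ := by
  rw [Matrix.J, fromBlocks_multiply, fromBlocks_multiply]
  simp

/-- A matrix commuting with `J` is a «rotation» `(A B; −B A)`. [folklore] -/
theorem eq_rotation_of_commute_J {E : Matrix (l ⊕ l) (l ⊕ l) ℂ} (hE : Matrix.J l ℂ * E = E * Matrix.J l ℂ) :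
    E = fromBlocks E.toBlocks₁₁ E.toBlocks₁₂ (-E.toBlocks₁₂) E.toBlocks₁₁ := by
  have h := hE
  rw [← fromBlocks_toBlocks E, Matrix.J, fromBlocks_multiply, fromBlocks_multiply] at h
  simp only [Matrix.zero_mul, Matrix.mul_zero, zero_add, add_zero, Matrix.neg_mul, Matrix.one_mul, Matrix.mul_one,
    Matrix.mul_neg] at h
  obtain ⟨h11, h12, h21, h22⟩ := fromBlocks_inj.1 h
  -- `h11 : −E₂₁ = E₁₂`, `h22 : E₁₂·? …`: read off `E₂₁ = −E₁₂`, `E₂₂ = E₁₁`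
  conv_lhs => rw [← fromBlocks_toBlocks E]
  congr 1
  · rw [← h11, neg_neg]
  · exact h21.symm

/-- `exp (t κ(b))` commutes with `J`. [folklore] -/
theorem J_mul_exp_kappa (b : Matrix l l ℂ) (t : ℝ) :
    Matrix.J l ℂ * exp (t • (fromBlocks 0 b (-b) 0 : Matrix (l ⊕ l) (l ⊕ l) ℂ)) =
      exp (t • (fromBlocks 0 b (-b) 0 : Matrix (l ⊕ l) (l ⊕ l) ℂ)) * Matrix.J l ℂ := by
  set U : (Matrix (l ⊕ l) (l ⊕ l) ℂ)ˣ :=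
    ⟨Matrix.J l ℂ, -Matrix.J l ℂ, by rw [Matrix.mul_neg, Matrix.J_squared, neg_neg],
      by rw [Matrix.neg_mul, Matrix.J_squared, neg_neg]⟩ with hU
  have hconj : (U : Matrix (l ⊕ l) (l ⊕ l) ℂ) * (t • (fromBlocks 0 b (-b) 0 : Matrix (l ⊕ l) (l ⊕ l) ℂ)) *
      (U⁻¹ : (Matrix (l ⊕ l) (l ⊕ l) ℂ)ˣ) = t • fromBlocks 0 b (-b) 0 := by
    show Matrix.J l ℂ * (t • fromBlocks 0 b (-b) 0) * (-Matrix.J l ℂ) = _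
    rw [Matrix.mul_smul, J_mul_kappa, Matrix.smul_mul, Matrix.mul_assoc, Matrix.mul_neg, Matrix.J_squared, neg_neg,
      Matrix.mul_one]
  have h := Matrix.exp_units_conj U (t • (fromBlocks 0 b (-b) 0 : Matrix (l ⊕ l) (l ⊕ l) ℂ))
  rw [hconj] at h
  -- `h : exp (tκ) = J exp(tκ) (−J)`
  have h2 : exp (t • (fromBlocks 0 b (-b) 0 : Matrix (l ⊕ l) (l ⊕ l) ℂ)) =
      Matrix.J l ℂ * exp (t • (fromBlocks 0 b (-b) 0 : Matrix (l ⊕ l) (l ⊕ l) ℂ)) * (-Matrix.J l ℂ) := h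
  symm
  calc exp (t • (fromBlocks 0 b (-b) 0 : Matrix (l ⊕ l) (l ⊕ l) ℂ)) * Matrix.J l ℂ
      = Matrix.J l ℂ * exp (t • (fromBlocks 0 b (-b) 0 : Matrix (l ⊕ l) (l ⊕ l) ℂ)) * (-Matrix.J l ℂ) * Matrix.J l ℂ := by
        rw [← h2]
    _ = Matrix.J l ℂ * exp (t • (fromBlocks 0 b (-b) 0 : Matrix (l ⊕ l) (l ⊕ l) ℂ)) := by
        rw [Matrix.mul_assoc, Matrix.neg_mul, Matrix.J_squared, neg_neg, Matrix.mul_one]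

/-- `exp (t κ(b))` is unitary for hermitian `b`. [folklore] -/
theorem conjTranspose_exp_kappa_mul {b : Matrix l l ℂ} (hb : bᴴ = b) (t : ℝ) :
    (exp (t • (fromBlocks 0 b (-b) 0 : Matrix (l ⊕ l) (l ⊕ l) ℂ)))ᴴ *
      exp (t • (fromBlocks 0 b (-b) 0 : Matrix (l ⊕ l) (l ⊕ l) ℂ)) = 1 := by
  have hskew : (t • (fromBlocks 0 b (-b) 0 : Matrix (l ⊕ l) (l ⊕ l) ℂ))ᴴ = -(t • fromBlocks 0 b (-b) 0) := by
    rw [conjTranspose_smul, star_trivial, fromBlocks_conjTranspose, conjTranspose_zero, conjTranspose_neg, hb, ← smul_neg,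
      fromBlocks_neg, neg_zero, neg_neg]
  have hdet : IsUnit (exp (t • (fromBlocks 0 b (-b) 0 : Matrix (l ⊕ l) (l ⊕ l) ℂ))).det :=
    (Matrix.isUnit_iff_isUnit_det _).1 (Matrix.isUnit_exp _)
  rw [← Matrix.exp_conjTranspose, hskew, Matrix.exp_neg, nonsing_inv_mul _ hdet]

/-- **`exp (t κ(b))` fixes the base point `i·1`** (and lies in `U(J)`), for hermitian `b`. [cite: Shimura1997, §6.5] -/
theorem moeb_exp_smul_kappa {b : Matrix l l ℂ} (hb : bᴴ = b) (t : ℝ) :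
    (exp (t • (fromBlocks 0 b (-b) 0 : Matrix (l ⊕ l) (l ⊕ l) ℂ)))ᴴ * Matrix.J l ℂ *
        exp (t • (fromBlocks 0 b (-b) 0 : Matrix (l ⊕ l) (l ⊕ l) ℂ)) = Matrix.J l ℂ ∧
      moeb (exp (t • (fromBlocks 0 b (-b) 0 : Matrix (l ⊕ l) (l ⊕ l) ℂ))) (I • 1) = I • 1 := by
  set E := exp (t • (fromBlocks 0 b (-b) 0 : Matrix (l ⊕ l) (l ⊕ l) ℂ)) with hE
  have hrot := eq_rotation_of_commute_J (J_mul_exp_kappa b t)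
  rw [← hE] at hrot
  have hunit := conjTranspose_exp_kappa_mul hb t
  rw [← hE] at hunit
  -- read off `AᴴA + BᴴB = 1`, `AᴴB = BᴴA` from `Eᴴ E = 1`
  rw [hrot, fromBlocks_conjTranspose, fromBlocks_multiply, ← fromBlocks_one] at hunit
  obtain ⟨h11, h12, -, -⟩ := fromBlocks_inj.1 hunit
  rw [conjTranspose_neg, Matrix.neg_mul, ← sub_eq_add_neg] at h12
  have h1 : (E.toBlocks₁₁)ᴴ * E.toBlocks₁₁ + (E.toBlocks₁₂)ᴴ * E.toBlocks₁₂ = 1 := by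
    rw [conjTranspose_neg, Matrix.neg_mul, Matrix.mul_neg, neg_neg] at h11
    exact h11
  have h2 : (E.toBlocks₁₁)ᴴ * E.toBlocks₁₂ = (E.toBlocks₁₂)ᴴ * E.toBlocks₁₁ := sub_eq_zero.1 h12
  rw [hrot]
  exact rotation_mem_and_moeb_I h1 h2

/-! ## §2 The `K∞`-type derivative -/

section KType

variable {σ : Type*} [Fintype σ] [DecidableEq σ] {n : ℕ}

/-- **The `K∞`-type derivative.**  Under (T) and (L), `D s (κ b) g = i·k_s·tr(b)·Φ g` for hermitian `b` and `g ∈ U(J)^σ`.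
[cite: Bump1997, §2.1] -/
theorem lieDeriv_kappa (k : σ → ℤ) (Φ : (σ → Matrix (Fin n ⊕ Fin n) (Fin n ⊕ Fin n) ℂ) → ℂ)
    (hT : ∀ g u : σ → Matrix (Fin n ⊕ Fin n) (Fin n ⊕ Fin n) ℂ,
      (∀ s, (g s)ᴴ * Matrix.J (Fin n) ℂ * g s = Matrix.J (Fin n) ℂ) →
      (∀ s, (u s)ᴴ * Matrix.J (Fin n) ℂ * u s = Matrix.J (Fin n) ℂ) → (∀ s, moeb (u s) (I • 1) = I • 1) →
      Φ (g * u) = (∏ s, (denom (u s) (I • (1 : Matrix (Fin n) (Fin n) ℂ))).det ^ k s)⁻¹ * Φ g)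
    (D : σ → Matrix (Fin n ⊕ Fin n) (Fin n ⊕ Fin n) ℂ → (σ → Matrix (Fin n ⊕ Fin n) (Fin n ⊕ Fin n) ℂ) → ℂ)
    (hD : ∀ (s : σ) (Y : Matrix (Fin n ⊕ Fin n) (Fin n ⊕ Fin n) ℂ) (g : σ → Matrix (Fin n ⊕ Fin n) (Fin n ⊕ Fin n) ℂ),
      Yᴴ * Matrix.J (Fin n) ℂ + Matrix.J (Fin n) ℂ * Y = 0 →
      (∀ s', (g s')ᴴ * Matrix.J (Fin n) ℂ * g s' = Matrix.J (Fin n) ℂ) →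
      HasDerivAt (fun t : ℝ => Φ (Function.update g s (g s * exp (t • Y)))) (D s Y g) 0)
    (s : σ) {b : Matrix (Fin n) (Fin n) ℂ} (hb : bᴴ = b) {g : σ → Matrix (Fin n ⊕ Fin n) (Fin n ⊕ Fin n) ℂ}
    (hg : ∀ s', (g s')ᴴ * Matrix.J (Fin n) ℂ * g s' = Matrix.J (Fin n) ℂ) :
    D s (fromBlocks 0 b (-b) 0) g = I * (k s : ℂ) * b.trace * Φ g := by
  classical
  set κ : Matrix (Fin n ⊕ Fin n) (Fin n ⊕ Fin n) ℂ := fromBlocks 0 b (-b) 0 with hκ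
  -- (T) along the rotation group: `Φ (update g s (g s · exp tκ)) = det(denom (exp tκ) (i·1))^{-k s} Φ g`
  have hval : ∀ t : ℝ, Φ (Function.update g s (g s * exp (t • κ))) =
      ((denom (exp (t • κ)) (I • (1 : Matrix (Fin n) (Fin n) ℂ))).det ^ k s)⁻¹ * Φ g := by
    intro t
    obtain ⟨hU, hI⟩ := moeb_exp_smul_kappa hb t
    have hupd : Function.update g s (g s * exp (t • κ)) =
        g * Function.update (1 : σ → Matrix (Fin n ⊕ Fin n) (Fin n ⊕ Fin n) ℂ) s (exp (t • κ)) := by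
      funext s'
      by_cases hs : s' = s
      · subst hs; rw [Pi.mul_apply, Function.update_self, Function.update_self]
      · rw [Pi.mul_apply, Function.update_of_ne hs, Function.update_of_ne hs, Pi.one_apply, Matrix.mul_one]
    have huU : ∀ s', (Function.update (1 : σ → Matrix (Fin n ⊕ Fin n) (Fin n ⊕ Fin n) ℂ) s (exp (t • κ)) s')ᴴ *
        Matrix.J (Fin n) ℂ * Function.update (1 : σ → Matrix (Fin n ⊕ Fin n) (Fin n ⊕ Fin n) ℂ) s (exp (t • κ)) s' =
        Matrix.J (Fin n) ℂ := by
      intro s'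
      by_cases hs : s' = s
      · subst hs; rw [Function.update_self]; exact hU
      · rw [Function.update_of_ne hs, Pi.one_apply, conjTranspose_one, Matrix.one_mul, Matrix.mul_one]
    have huI : ∀ s', moeb (Function.update (1 : σ → Matrix (Fin n ⊕ Fin n) (Fin n ⊕ Fin n) ℂ) s (exp (t • κ)) s')
        (I • (1 : Matrix (Fin n) (Fin n) ℂ)) = I • 1 := by
      intro s'
      by_cases hs : s' = s
      · subst hs; rw [Function.update_self]; exact hI
      · rw [Function.update_of_ne hs, Pi.one_apply, moeb_one]
    rw [hupd, hT g _ hg huU huI]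
    congr 2
    rw [← Finset.prod_erase_mul _ _ (Finset.mem_univ s), Function.update_self]
    rw [Finset.prod_eq_one fun s' hs' => ?_, one_mul]
    rw [Function.update_of_ne (Finset.ne_of_mem_erase hs'), Pi.one_apply, denom_def, ← fromBlocks_one, toBlocks_fromBlocks₂₁,
      toBlocks_fromBlocks₂₂, Matrix.zero_mul, zero_add, det_one, _root_.one_zpow]
  -- the derivative of `t ↦ det(denom (exp tκ) (i·1))` at `0` is `−i tr b` (★ E-3 Jacobi along `Λ := t ↦ t•κ`)
  set Λ : ℝ →L[ℝ] Matrix (Fin n ⊕ Fin n) (Fin n ⊕ Fin n) ℂ := (ContinuousLinearMap.id ℝ ℝ).smulRight κ with hΛ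
  have hΛapp : ∀ t : ℝ, Λ t = t • κ := fun t => by simp [hΛ]
  obtain ⟨Lh, hh, hLh⟩ := exists_hasFDerivAt_det_denom_exp (l := Fin n) Λ
  have hh' : HasDerivAt (fun t : ℝ => (denom (exp (t • κ)) (I • (1 : Matrix (Fin n) (Fin n) ℂ))).det) (-(I * b.trace)) 0 := by
    have h1 := hh.hasDerivAt
    have hval1 : Lh 1 = -(I * b.trace) := by
      rw [hLh, hΛapp, one_smul, hκ, toBlocks_fromBlocks₂₁, toBlocks_fromBlocks₂₂, add_zero, smul_neg, trace_neg, trace_smul,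
        smul_eq_mul]
    rw [hval1] at h1
    refine h1.congr_of_eventuallyEq (Eventually.of_forall fun t => ?_)
    simp only [hΛapp]
  have hh0 : (denom (exp ((0 : ℝ) • κ)) (I • (1 : Matrix (Fin n) (Fin n) ℂ))).det = 1 := by
    rw [zero_smul, NormedSpace.exp_zero, denom_def, ← fromBlocks_one, toBlocks_fromBlocks₂₁, toBlocks_fromBlocks₂₂,
      Matrix.zero_mul, zero_add, det_one]
  -- `t ↦ det(…)^{-k} Φ g` has derivative `(-k)·(−i tr b)·Φ g = i k tr b Φ g`
  have hpow : HasDerivAt (fun t : ℝ => ((denom (exp (t • κ)) (I • (1 : Matrix (Fin n) (Fin n) ℂ))).det ^ k s)⁻¹ * Φ g)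
      (I * (k s : ℂ) * b.trace * Φ g) 0 := by
    have hz := hasDerivAt_zpow (-(k s)) (1 : ℂ) (Or.inl one_ne_zero)
    rw [← hh0] at hz
    have hc := hz.comp 0 hh'
    rw [hh0] at hc
    have hc' : HasDerivAt (fun t : ℝ => (denom (exp (t • κ)) (I • (1 : Matrix (Fin n) (Fin n) ℂ))).det ^ (-(k s)))
        (I * (k s : ℂ) * b.trace) 0 := by
      refine hc.congr_deriv ?_
      rw [_root_.one_zpow, mul_one, Int.cast_neg]
      ring
    have hm := hc'.mul_const (Φ g)
    refine hm.congr_of_eventuallyEq (Eventually.of_forall fun t => ?_)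
    simp only [_root_.zpow_neg]
  -- uniqueness of the derivative
  have hL := hD s κ g (kappa_gen_mem hb) hg
  have hfun : (fun t : ℝ => Φ (Function.update g s (g s * exp (t • κ)))) =
      fun t : ℝ => ((denom (exp (t • κ)) (I • (1 : Matrix (Fin n) (Fin n) ℂ))).det ^ k s)⁻¹ * Φ g := funext hval
  rw [hfun] at hL
  exact hL.unique hpow

/-! ## §3 The dictionary in Cartan form -/

/-- **THE HERMITIAN-TUBE CAUCHY–RIEMANN DICTIONARY (Cartan form).**  As ★ `exists_holDescend_of_lieCRP`, with the Cauchy–Riemann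
hypothesis in the CARTAN form `D s (μ b) g = i·D s (σ b) g` — «`D` kills `𝔭⁻_tube = {μ(b) − iσ(b)}`» in the letters of
★ `K2LiuHermitianTubeFramePMinus` —: the group function descends to a HOLOMORPHIC function on `ℌ_n^σ` with the (E0) dictionary
(the `hE0`/`hhol` binders of ★ `K2LiuHolTubeRigidity.eq_zero_of_hol_of_transl_invariant`). [cite: Shimura1997, §§5–6] [cite: Bump1997, §2.1] -/
theorem exists_holDescend_of_lieCR (k : σ → ℤ) (Φ : (σ → Matrix (Fin n ⊕ Fin n) (Fin n ⊕ Fin n) ℂ) → ℂ)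
    (hT : ∀ g u : σ → Matrix (Fin n ⊕ Fin n) (Fin n ⊕ Fin n) ℂ,
      (∀ s, (g s)ᴴ * Matrix.J (Fin n) ℂ * g s = Matrix.J (Fin n) ℂ) →
      (∀ s, (u s)ᴴ * Matrix.J (Fin n) ℂ * u s = Matrix.J (Fin n) ℂ) → (∀ s, moeb (u s) (I • 1) = I • 1) →
      Φ (g * u) = (∏ s, (denom (u s) (I • (1 : Matrix (Fin n) (Fin n) ℂ))).det ^ k s)⁻¹ * Φ g)
    (D : σ → Matrix (Fin n ⊕ Fin n) (Fin n ⊕ Fin n) ℂ → (σ → Matrix (Fin n ⊕ Fin n) (Fin n ⊕ Fin n) ℂ) → ℂ)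
    (hD : ∀ (s : σ) (Y : Matrix (Fin n ⊕ Fin n) (Fin n ⊕ Fin n) ℂ) (g : σ → Matrix (Fin n ⊕ Fin n) (Fin n ⊕ Fin n) ℂ),
      Yᴴ * Matrix.J (Fin n) ℂ + Matrix.J (Fin n) ℂ * Y = 0 →
      (∀ s', (g s')ᴴ * Matrix.J (Fin n) ℂ * g s' = Matrix.J (Fin n) ℂ) →
      HasDerivAt (fun t : ℝ => Φ (Function.update g s (g s * exp (t • Y)))) (D s Y g) 0)
    (hDl : ∀ (s : σ) (g : σ → Matrix (Fin n ⊕ Fin n) (Fin n ⊕ Fin n) ℂ) (a : ℝ)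
      (Y Y' : Matrix (Fin n ⊕ Fin n) (Fin n ⊕ Fin n) ℂ),
      Yᴴ * Matrix.J (Fin n) ℂ + Matrix.J (Fin n) ℂ * Y = 0 → Y'ᴴ * Matrix.J (Fin n) ℂ + Matrix.J (Fin n) ℂ * Y' = 0 →
      (∀ s', (g s')ᴴ * Matrix.J (Fin n) ℂ * g s' = Matrix.J (Fin n) ℂ) →
      D s (a • Y + Y') g = (a : ℂ) * D s Y g + D s Y' g)
    (hDc : ∀ (s : σ) (Y : Matrix (Fin n ⊕ Fin n) (Fin n ⊕ Fin n) ℂ), Yᴴ * Matrix.J (Fin n) ℂ + Matrix.J (Fin n) ℂ * Y = 0 →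
      ContinuousOn (D s Y) {g | ∀ s', (g s')ᴴ * Matrix.J (Fin n) ℂ * g s' = Matrix.J (Fin n) ℂ})
    (hCR : ∀ (s : σ) (b : Matrix (Fin n) (Fin n) ℂ) (g : σ → Matrix (Fin n ⊕ Fin n) (Fin n ⊕ Fin n) ℂ), bᴴ = b →
      (∀ s', (g s')ᴴ * Matrix.J (Fin n) ℂ * g s' = Matrix.J (Fin n) ℂ) →
      D s (fromBlocks b 0 0 (-b)) g = I * D s (fromBlocks 0 b b 0) g) :
    ∃ f : (σ → Matrix (Fin n) (Fin n) ℂ) → ℂ,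
      (∀ g : σ → Matrix (Fin n ⊕ Fin n) (Fin n ⊕ Fin n) ℂ, (∀ s, (g s)ᴴ * Matrix.J (Fin n) ℂ * g s = Matrix.J (Fin n) ℂ) →
        f (fun s => moeb (g s) (I • 1)) = (∏ s, (denom (g s) (I • (1 : Matrix (Fin n) (Fin n) ℂ))).det ^ k s) * Φ g) ∧
      DifferentiableOn ℂ (fun z : σ → Fin n → Fin n → ℂ => f fun s => Matrix.of (z s))
        {z | ∀ s, Matrix.of (z s) ∈ hermUpperHalfSpace n} := by
  refine exists_holDescend_of_lieCRP k Φ hT D hD hDl hDc fun s b g hb hg => ?_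
  -- `μ − 2iν = (μ − iσ) − iκ` and the `K∞`-type derivative
  have h2ν : (2 : ℂ) * D s (fromBlocks 0 b 0 0) g = D s (fromBlocks 0 b b 0) g + D s (fromBlocks 0 b (-b) 0) g := by
    have h := lieDeriv_smul D hDl s hg 2 (transl_gen_mem hb)
    rw [two_smul_transl_gen, hDl s g 1 _ _ (sigma_gen_mem hb) (kappa_gen_mem hb) hg, Complex.ofReal_one, one_mul] at h
    push_cast at h
    exact h.symm
  have hκ := lieDeriv_kappa k Φ hT D hD s hb hg
  rw [hCR s b g hb hg]
  linear_combination (-I) * h2ν + (-I) * hκ + (-((k s : ℂ) * b.trace * Φ g)) * Complex.I_mul_I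

end KType

end Summit.HodgeConjecture.HodgeConjecture.Cruxes.HLiu418.K2LiuHermitianTubeCRCartan

end
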